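/-
Copyright: cell `pub-ymgap` (HUMAN RULING D-0062), Track A of `YM-PLAN.md`, DAG node N20 (= NE7b); R134 acceleration seat
`pub-ymgap-dag-n20-c` (strategy s1, generation 3), module 16.  Released under the licence of the surrounding project.
-/
import Summits.QuantumFields.YangMills.Theorems.BalabanUVNodesN20LCSConditionalLevelOne
import HarnessLib

/-!
# YM-DAG node N20 (= NE7b), strategy s1, module 16: CONDITIONAL COARSE LARGE-FIELD SPARSENESS — in the small-field-restricted level-0 state,
# the event «every averaged plaquette of `X` is `ε₁`-large» costs `e^{−(δβε₁ − Cδ)·#X}`: the PointwiseExtraction × LCS product of row NE7b's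
# Peierls bookkeeping at the first 𝐑𝐓 step, for the all-small history, uniformly in `β ≥ 4N` and in the volume

Track A of `YM-PLAN.md` (cell `pub-ymgap`, HUMAN RULING D-0062), node **N20** = spine estimate NE7b (`T4WeightBudget.RelWeightBound` — the
cell `pub-balaban`'s OWN estimate, NOT PRINTED in [Bałaban 1983–89], NOT PROVED).  Seat `pub-ymgap-dag-n20-c` (R134, s1), module 16
(module 15: `…N20LCSConditionalLevelOne`, the conditional (LS) rung 1; module 7: `…N20LCSAtRecordLevelZero`, the Chebyshev split
`indicator_largeField_le`).  Kernel theorems only: 0 `def`, 0 `sorry`, standard axioms; COUNT-NEUTRAL; `--supports` the K3′ item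
`SpineGivenEndpointR12` (stmt-QuantumFields-19908) as a helper.  Nothing of Bałaban's is asserted.

WHY.  Row NE7b's count is «extracted cost beats stability volume cost» (`LocalConditionalStability.sum_admS_integral_le_of_LCS`: per step,
`PointwiseExtraction` gives `χ ≤ e^{−a}·M` and `LocCondStability` gives `∫ M·eterm ≤ e^{b}·∫ eterm`).  At the first 𝐑𝐓 step of the all-small
history, `eterm`'s level-0 density is `χ_ε·e^{−βA}`, the pinned large-field event of the NEXT level is «`1 − Re tr Ū(∂p′) ≥ ε₁` on `X`», its
Chebyshev carrier is `M = e^{δβΣ_{p′∈X}(1 − Re tr Ū(∂p′))}` with `a = δβε₁#X`, and module 15 is `b = Cδ#X`: THIS FILE records the product.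

WHAT IS PROVED ([folklore]): `indicator_largeField_avgFun_le` (the Chebyshev split for the averaged field), ★★ **`condSparseness_avgFun`** —
with `δ₀, C, c` of `condLocalExpMoment_avgFun`: for `d = 4`, `P.L = L`, `1 ≤ m+K`, `β ≥ 4N`, `βε ≥ c`, `0 ≤ δ ≤ δ₀`, every `ε₁` and every finite set
`X` of level-1 plaquettes,
`∫ 𝟙[∀ p′ ∈ X, 1 − Re tr Ū(∂p′) ≥ ε₁]·χ_ε·e^{−βA} ∏dU ≤ e^{−(δβε₁ − Cδ)·#X} · ∫ χ_ε·e^{−βA} ∏dU` — the conditional twin of n20-d's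
`gibbsMeasure_largeField_avgFun_le` and of module 5's coarse sparseness: in the restricted state, coarse large fields are exponentially sparse
at rate `δ(βε₁ − C)` per averaged plaquette, uniformly in the volume.

HONEST FRAMING.  First 𝐑𝐓 step, all-small history, fine-level currency; nothing about the record's `χ₁(Ū)·w`-dressed state (HANDOFF §2c of the
seat), levels `≥ 2`, or the (α)-instance (NC-NE7b-α UNRULED).  NE7b NOT PRINTED ∕ NOT PROVED; (α)-instance 0∕1; N20 NOT discharged; typed
28∕28, discharged count untouched; NOT ℝ⁴, NOT infinite volume, NOT OS axioms, NOT a mass gap, NOT Clay.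
-/

set_option autoImplicit false

noncomputable section

namespace Summit.QuantumFields.YangMills.BalabanUVNodes.N20LCSConditional

open MeasureTheory Finset
open Literature.MathematicalPhysics.QuantumFieldTheory.Balaban1983to89
open T4Continuum T4ReflectionCone BlockAveraging ExpMeanLog
open Summit.QuantumFields.YangMills.BalabanUVNodes.N20LCSAvgExpMoment (measurable_exp_plaqSum_avgFun)

variable {N : ℕ} [NeZero N]

/-! ## §9 Conditional coarse large-field sparseness -/

/-- The Chebyshev split for the averaged field: `𝟙[∀ p′ ∈ X, ε₁ ≤ 1 − Re tr Ū(∂p′)] ≤ e^{−sε₁#X}·e^{s·Σ_{p′∈X}(1 − Re tr Ū(∂p′))}` (`s ≥ 0`).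
[folklore] -/
theorem indicator_largeField_avgFun_le (P : Params) {s : ℝ} (hs : 0 ≤ s) (ε₁ : ℝ) (X : Finset (Plaq P 1))
    (U : GaugeField P 0 (Matrix.specialUnitaryGroup (Fin N) ℂ)) :
    Set.indicator {U : GaugeField P 0 (Matrix.specialUnitaryGroup (Fin N) ℂ) | ∀ p ∈ X, ε₁ ≤ 1 - reTr (GaugeField.plaqHol (avgFun (expMeanLogSU (n := Fin N)) U) p)} (fun _ => (1 : ℝ)) U ≤
      Real.exp (-(s * (ε₁ * X.card))) * Real.exp (s * ∑ p ∈ X, (1 - reTr (GaugeField.plaqHol (avgFun (expMeanLogSU (n := Fin N)) U) p))) := by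
  classical
  by_cases hU : U ∈ {U : GaugeField P 0 (Matrix.specialUnitaryGroup (Fin N) ℂ) |
      ∀ p ∈ X, ε₁ ≤ 1 - reTr (GaugeField.plaqHol (avgFun (expMeanLogSU (n := Fin N)) U) p)}
  · rw [Set.indicator_of_mem hU, ← Real.exp_add]
    refine Real.one_le_exp ?_
    have hsum : ε₁ * X.card ≤ ∑ p ∈ X, (1 - reTr (GaugeField.plaqHol (avgFun (expMeanLogSU (n := Fin N)) U) p)) := by
      calc ε₁ * X.card = ∑ _p ∈ X, ε₁ := by rw [Finset.sum_const, nsmul_eq_mul, mul_comm]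
        _ ≤ ∑ p ∈ X, (1 - reTr (GaugeField.plaqHol (avgFun (expMeanLogSU (n := Fin N)) U) p)) := Finset.sum_le_sum fun p hp => hU p hp
    nlinarith
  · rw [Set.indicator_of_notMem hU]
    positivity

/-- **CONDITIONAL COARSE LARGE-FIELD SPARSENESS** (all-small history, first 𝐑𝐓 step): see the module docstring.  Chebyshev
(`indicator_largeField_avgFun_le` at `s = δβ`) times module 15's conditional (LS) rung 1. [folklore] -/
theorem condSparseness_avgFun (N : ℕ) [NeZero N] (L : ℕ) :
    ∃ δ₀ : ℝ, 0 < δ₀ ∧ ∃ C c : ℝ, 0 ≤ C ∧ 0 < c ∧ ∀ (P : Params), P.d = 4 → P.L = L → 1 ≤ P.m + P.K →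
      ∀ (β ε δ ε₁ : ℝ), 4 * N ≤ β → c ≤ β * ε → 0 ≤ δ → δ ≤ δ₀ → ∀ (X : Finset (Plaq P 1)),
        ∫ U, (Set.indicator {U : GaugeField P 0 (Matrix.specialUnitaryGroup (Fin N) ℂ) | ∀ p ∈ X, ε₁ ≤ 1 - reTr (GaugeField.plaqHol (avgFun (expMeanLogSU (n := Fin N)) U) p)} (fun _ => (1 : ℝ)) U * ∏ p : Plaq P 0, (if 1 - reTr (GaugeField.plaqHol U p) ≤ ε then (1 : ℝ) else 0)) * Missing.boltzmann P β U ∂(fieldMeasure P 0 (Matrix.specialUnitaryGroup (Fin N) ℂ)) ≤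
          Real.exp (-((δ * β * ε₁ - C * δ) * X.card)) *
            ∫ U, (∏ p : Plaq P 0, (if 1 - reTr (GaugeField.plaqHol U p) ≤ ε then (1 : ℝ) else 0)) * Missing.boltzmann P β U ∂(fieldMeasure P 0 (Matrix.specialUnitaryGroup (Fin N) ℂ)) := by
  classical
  obtain ⟨δ₀, hδ₀, C, c, hC0, hc, hLS1⟩ := condLocalExpMoment_avgFun N L
  refine ⟨δ₀, hδ₀, C, c, hC0, hc, fun P hd hL hmK β ε δ ε₁ hβ hcε hδ0 hδ1 X => ?_⟩
  have hNpos : (0 : ℝ) < N := Nat.cast_pos.mpr (Nat.pos_of_ne_zero (NeZero.ne N))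
  have hβ0 : 0 ≤ β := le_trans (by positivity) hβ
  obtain ⟨hint, hle⟩ := hLS1 P hd hL hmK β ε δ hβ hcε hδ0 hδ1 X
  have hW0 : ∀ U : GaugeField P 0 (Matrix.specialUnitaryGroup (Fin N) ℂ), 0 ≤ ∏ p : Plaq P 0, (if 1 - reTr (GaugeField.plaqHol U p) ≤ ε then (1 : ℝ) else 0) := fun U => Finset.prod_nonneg fun p _ => by split_ifs <;> norm_num
  -- pointwise Chebyshev
  have hpt : ∀ U : GaugeField P 0 (Matrix.specialUnitaryGroup (Fin N) ℂ),
      (Set.indicator {U : GaugeField P 0 (Matrix.specialUnitaryGroup (Fin N) ℂ) | ∀ p ∈ X, ε₁ ≤ 1 - reTr (GaugeField.plaqHol (avgFun (expMeanLogSU (n := Fin N)) U) p)} (fun _ => (1 : ℝ)) U * ∏ p : Plaq P 0, (if 1 - reTr (GaugeField.plaqHol U p) ≤ ε then (1 : ℝ) else 0)) * Missing.boltzmann P β U ≤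
        Real.exp (-(δ * β * (ε₁ * X.card))) *
          ((Real.exp (δ * β * ∑ p ∈ X, (1 - reTr (GaugeField.plaqHol (avgFun (expMeanLogSU (n := Fin N)) U) p))) * ∏ p : Plaq P 0, (if 1 - reTr (GaugeField.plaqHol U p) ≤ ε then (1 : ℝ) else 0)) * Missing.boltzmann P β U) := by
    intro U
    have h := indicator_largeField_avgFun_le (N := N) P (mul_nonneg hδ0 hβ0) ε₁ X U
    have hrest : 0 ≤ (∏ p : Plaq P 0, (if 1 - reTr (GaugeField.plaqHol U p) ≤ ε then (1 : ℝ) else 0)) * Missing.boltzmann P β U := mul_nonneg (hW0 U) (Missing.boltzmann_pos P β U).le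
    calc (Set.indicator {U : GaugeField P 0 (Matrix.specialUnitaryGroup (Fin N) ℂ) | ∀ p ∈ X, ε₁ ≤ 1 - reTr (GaugeField.plaqHol (avgFun (expMeanLogSU (n := Fin N)) U) p)} (fun _ => (1 : ℝ)) U * ∏ p : Plaq P 0, (if 1 - reTr (GaugeField.plaqHol U p) ≤ ε then (1 : ℝ) else 0)) * Missing.boltzmann P β U
        = (Set.indicator {U : GaugeField P 0 (Matrix.specialUnitaryGroup (Fin N) ℂ) | ∀ p ∈ X, ε₁ ≤ 1 - reTr (GaugeField.plaqHol (avgFun (expMeanLogSU (n := Fin N)) U) p)} (fun _ => (1 : ℝ)) U) * ((∏ p : Plaq P 0, (if 1 - reTr (GaugeField.plaqHol U p) ≤ ε then (1 : ℝ) else 0)) * Missing.boltzmann P β U) := by ring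
      _ ≤ (Real.exp (-(δ * β * (ε₁ * X.card))) * Real.exp (δ * β * ∑ p ∈ X, (1 - reTr (GaugeField.plaqHol (avgFun (expMeanLogSU (n := Fin N)) U) p)))) * ((∏ p : Plaq P 0, (if 1 - reTr (GaugeField.plaqHol U p) ≤ ε then (1 : ℝ) else 0)) * Missing.boltzmann P β U) :=
          mul_le_mul_of_nonneg_right h hrest
      _ = _ := by ring
  -- integrate
  have hI := integral_mono_of_nonneg (μ := fieldMeasure P 0 (Matrix.specialUnitaryGroup (Fin N) ℂ)) (ae_of_all _ fun U => ?_) (hint.const_mul _) (ae_of_all _ hpt)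
  · refine hI.trans ?_
    rw [integral_const_mul]
    calc Real.exp (-(δ * β * (ε₁ * X.card))) *
          ∫ U, (Real.exp (δ * β * ∑ p ∈ X, (1 - reTr (GaugeField.plaqHol (avgFun (expMeanLogSU (n := Fin N)) U) p))) * ∏ p : Plaq P 0, (if 1 - reTr (GaugeField.plaqHol U p) ≤ ε then (1 : ℝ) else 0)) * Missing.boltzmann P β U ∂(fieldMeasure P 0 (Matrix.specialUnitaryGroup (Fin N) ℂ))
        ≤ Real.exp (-(δ * β * (ε₁ * X.card))) * (Real.exp (C * δ * X.card) *
            ∫ U, (∏ p : Plaq P 0, (if 1 - reTr (GaugeField.plaqHol U p) ≤ ε then (1 : ℝ) else 0)) * Missing.boltzmann P β U ∂(fieldMeasure P 0 (Matrix.specialUnitaryGroup (Fin N) ℂ))) :=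
          mul_le_mul_of_nonneg_left hle (Real.exp_pos _).le
      _ = Real.exp (-((δ * β * ε₁ - C * δ) * X.card)) * ∫ U, (∏ p : Plaq P 0, (if 1 - reTr (GaugeField.plaqHol U p) ≤ ε then (1 : ℝ) else 0)) * Missing.boltzmann P β U ∂(fieldMeasure P 0 (Matrix.specialUnitaryGroup (Fin N) ℂ)) := by
          rw [← mul_assoc, ← Real.exp_add]
          congr 2
          ring
  · exact mul_nonneg (mul_nonneg (Set.indicator_nonneg (fun _ _ => zero_le_one) U) (hW0 U)) (Missing.boltzmann_pos P β U).le

end Summit.QuantumFields.YangMills.BalabanUVNodes.N20LCSConditional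

end
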